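import Literature.MathematicalPhysics.QuantumLattice.PairFieldBoost
import Literature.MathematicalPhysics.QuantumLattice.HubbardTorusFluxBlochBound
import HarnessLib

/-!
# The boost ceiling: low-energy states with small uniform pair field

Soloist `solo-HubbardSuperconductivity-informed`, paper §12, Theorem 12.2 (★) — the obstruction
behind "door (c)" (symmetric pair-coupling / penalised variational principles): **on the Hubbard
torus `(ℤ/L)²` (`L ≥ 3`, nearest-neighbour hopping `t = 1`, any `U`), in every joint sector
`(N, S^z)` and for every normalised state `ψ` of the sector there is a normalised state `φ` of the
same sector — a Galilean (Bloch) boost `W_{±j} ψ`, `1 ≤ j ≤ M` — with**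

  `⟨φ, Δ_g† Δ_g φ⟩ + τ (⟨φ, H φ⟩ - ⟨ψ, H ψ⟩) ≤ C_g² L⁴ / M + 8π² (C_g² L² + τ) M²`

**for every `τ ≥ 0` and every `1 ≤ M < L/4`** (`exists_pairBoost_pair_add_energy_le`), where
`Δ_g = Σ_x P_x` is the uniform (zero-momentum) pair field of form factor `g` (`pairField`) and
`C_g` the local norm constant (`pairNormConst`; `C_d² = 32` for the `d`-wave factor). For a sector
ground state `ψ` this gives (`exists_small_pairField_low_energy_of_isGroundStateInSector`) a
normalised `φ` in the sector with SIMULTANEOUSLY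

  `‖Δ_g φ‖² ≤ B`  and  `τ (⟨φ, H φ⟩ - E₀(N, S^z)) ≤ B`,  `B = C_g² L⁴/M + 8π²(C_g² L² + τ) M²`.

Reading (paper §12): choosing `M ~ L^{2/3}` (`τ ≤ C_g² L²`) gives `‖Δ_g φ‖²/L⁴ ≲ L^{-2/3} → 0` at
excitation energy `≲ C_g² L^{10/3}/τ`; with `τ = κ⁻¹ L²·L⁴`-type penalties this is the statement
that the lowest eigenvalue of `Δ_g†Δ_g/L⁴ + τ(H - E₀)` on a sector is `o(1)` UNIFORMLY in the
state `ψ` one starts from — so no fixed-strength symmetric coupling of the uniform pair field to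
the energy can detect (or exclude) pair long-range order in the ground state: the variational
problem is won by boosted states whose pair field sits at momentum `±2j ≠ 0`, whatever the order.
This is the kernel form of the "boost ceiling" (★); it uses only gauge covariance, the Peierls
identity and Parseval, hence holds for every `U`, filling and form factor.

Proof: `W_sᴴ H W_s` is the uniformly twisted torus, so the energies of `W_{j}ψ` and `W_{-j}ψ`
add up to `2⟨ψ,Hψ⟩ + 4(1 - cos(2πj/L)) K(ψ) ≤ 2⟨ψ,Hψ⟩ + 16π²j²` (`|K| ≤ 2L²`; the current terms
cancel); `W_sᴴ Δ_g W_s = Δ_g(m_s) + O(2π|s| L C_g)` with `m_s = (-2s, 0)`, so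
`⟨W_sψ, Δ_g†Δ_g W_sψ⟩ ≤ 2‖Δ_g(m_s)ψ‖² + 8π²s²L²C_g²`; the labels `m_{±j}`, `1 ≤ j ≤ M`, are
pairwise distinct when `4M < L`, so by Parseval `Σ_j (‖Δ_g(m_j)ψ‖² + ‖Δ_g(m_{-j})ψ‖²) ≤
Σ_m ‖Δ_g(m)ψ‖² = L² Σ_x ‖P_xψ‖² ≤ C_g² L⁴`; summing over `j ≤ M` and pigeonholing gives the pair
`±j`, one member of which satisfies the bound. All ingredients are Literature facts
(`PairFieldBoost`, `PairFieldMomentum`, `MagneticHubbardTorusPeierls`).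

References: H. Watanabe, J. Stat. Phys. 177 (2019) 717, §2.2 [Watanabe2019]; D. Bohm, Phys. Rev.
75 (1949) 502 [Bohm1949]; H. Tasaki, J. Stat. Phys. 174 (2019) 735 (low-lying states vs LRO)
[cite: TadaKoma2016]; D. J. Scalapino, Phys. Rep. 250 (1995) 329, §2 [Scalapino1995].
-/

noncomputable section

namespace Summit.HubbardSuperconductivity.HubbardSuperconductivity.Theorems

open Matrix Finset Literature.Probability.LatticeModels
  Literature.MathematicalPhysics.QuantumLattice
  Literature.MathematicalPhysics.QuantumLattice.HubbardWave0
open scoped ComplexConjugate ComplexOrder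

variable {L : ℕ}

/-- `‖ψ‖ = 1` in `ℓ²` from the `dotProduct` normalisation `⟨ψ, ψ⟩ = 1`. -/
theorem norm_toLp_eq_one_of_star_dotProduct {ψ : Fock (Orb (FermionTorus 2 L))}
    (h1 : star ψ ⬝ᵥ ψ = 1) : ‖(WithLp.toLp 2 ψ :
        EuclideanSpace ℂ (Finset (Orb (FermionTorus 2 L))))‖ = 1 := by
  have h := norm_toLp_sq_eq_re ψ
  rw [h1, Complex.one_re] at h
  exact (pow_eq_one_iff_of_nonneg (norm_nonneg _) two_ne_zero).1 h

/-- **Boost labels are distinct in the window `|s| ≤ M < L/4`**: `m_s = m_{s'}` forces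
`2s ≡ 2s' (mod L)`, and `|2s - 2s'| ≤ 4M < L`. -/
theorem pairBoostLabel_intCast_inj {M : ℕ} (hML : 4 * M < L) {s s' : ℤ} (hs : |s| ≤ M)
    (hs' : |s'| ≤ M)
    (h : pairBoostLabel L ((s : ℤ) : ZMod L) = pairBoostLabel L ((s' : ℤ) : ZMod L)) : s = s' := by
  have h0 := congrFun h 0
  simp only [pairBoostLabel, Pi.single_eq_same, neg_inj] at h0
  have h1 : ((s + s : ℤ) : ZMod L) = ((s' + s' : ℤ) : ZMod L) := by push_cast; exact h0
  rw [ZMod.intCast_eq_intCast_iff_dvd_sub] at h1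
  have hM : ((4 * M : ℕ) : ℤ) < L := by exact_mod_cast hML
  have h2 : s' + s' - (s + s) = 0 := by
    refine Int.eq_zero_of_abs_lt_dvd h1 ?_
    have h3 := abs_le.1 hs
    have h4 := abs_le.1 hs'
    rw [abs_lt]
    push_cast at hM
    constructor <;> omega
  omega

variable [NeZero L]

/-- **Energy of the boost pair `W_{j}ψ, W_{-j}ψ`** (`L ≥ 3`, `⟨ψ,ψ⟩ = 1`): the two boosted
energies add up to at most `2⟨ψ, Hψ⟩ + 16π² j²` — the current terms `± 2 sin(2πj/L) J(ψ)` cancel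
and `4(1 - cos(2πj/L)) K(ψ) ≤ 2 (2πj/L)² |K(ψ)| ≤ 16π²j²` by `|K| ≤ 2L²`. -/
theorem re_energy_pairBoost_add_neg_le (hL : 3 ≤ L) (U : ℝ) (j : ℤ)
    {ψ : Fock (Orb (FermionTorus 2 L))} (h1 : star ψ ⬝ᵥ ψ = 1) :
    (star (pairBoost L ((j : ℤ) : ZMod L) *ᵥ ψ) ⬝ᵥ
          (hubbardTorus 2 L 1 U *ᵥ (pairBoost L ((j : ℤ) : ZMod L) *ᵥ ψ))).re +
        (star (pairBoost L ((-j : ℤ) : ZMod L) *ᵥ ψ) ⬝ᵥ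
          (hubbardTorus 2 L 1 U *ᵥ (pairBoost L ((-j : ℤ) : ZMod L) *ᵥ ψ))).re ≤
      2 * (star ψ ⬝ᵥ (hubbardTorus 2 L 1 U *ᵥ ψ)).re + 16 * Real.pi ^ 2 * (j : ℝ) ^ 2 := by
  rw [re_star_dotProduct_hubbardTorus_pairBoost_mulVec hL,
    re_star_dotProduct_hubbardTorus_pairBoost_mulVec hL]
  have hu : -(2 * Real.pi * ((-j : ℤ) : ℝ)) / L = -(-(2 * Real.pi * ((j : ℤ) : ℝ)) / L) := by
    push_cast; ring
  rw [hu, Real.cos_neg, Real.sin_neg]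
  set u : ℝ := -(2 * Real.pi * ((j : ℤ) : ℝ)) / L with hu_def
  have hL0 : (L : ℝ) ≠ 0 := Nat.cast_ne_zero.2 (NeZero.ne L)
  have hK : |e1HopRe L ψ| ≤ 2 * (L : ℝ) ^ 2 := abs_sum_re_hop_le h1
  have h1c : 0 ≤ 1 - Real.cos u := sub_nonneg.2 (Real.cos_le_one u)
  have hKle : (1 - Real.cos u) * e1HopRe L ψ ≤ (1 - Real.cos u) * |e1HopRe L ψ| :=
    mul_le_mul_of_nonneg_left (le_abs_self _) h1c
  have hcos : 2 * (1 - Real.cos u) * |e1HopRe L ψ| ≤ u ^ 2 * |e1HopRe L ψ| :=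
    two_mul_one_sub_cos_mul_le u _ (abs_nonneg _)
  have hu2 : u ^ 2 * (2 * (L : ℝ) ^ 2) = 8 * Real.pi ^ 2 * (j : ℝ) ^ 2 := by
    rw [hu_def]; field_simp; ring
  have hKu : u ^ 2 * |e1HopRe L ψ| ≤ u ^ 2 * (2 * (L : ℝ) ^ 2) :=
    mul_le_mul_of_nonneg_left hK (sq_nonneg u)
  linarith [hKle, hcos, hKu, hu2]

/-- **The pair term of a boosted state** (`⟨ψ,ψ⟩ = 1`):
`⟨W_sψ, Δ_g†Δ_g W_sψ⟩ = ‖(W_sᴴ Δ_g W_s)ψ‖² ≤ (‖Δ_g(m_s)ψ‖ + 2π|s| L C_g)² ≤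
2‖Δ_g(m_s)ψ‖² + 8π² s² L² C_g²`. -/
theorem re_pair_pairBoost_le (g : Site 2 → ℝ) (s : ℤ) {ψ : Fock (Orb (FermionTorus 2 L))}
    (h1 : star ψ ⬝ᵥ ψ = 1) :
    (star (pairBoost L ((s : ℤ) : ZMod L) *ᵥ ψ) ⬝ᵥ
        (((pairField g L)ᴴ * pairField g L) *ᵥ (pairBoost L ((s : ℤ) : ZMod L) *ᵥ ψ))).re ≤
      2 * ‖(WithLp.toLp 2 (pairFieldAt g L (pairBoostLabel L ((s : ℤ) : ZMod L)) *ᵥ ψ) :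
          EuclideanSpace ℂ (Finset (Orb (FermionTorus 2 L))))‖ ^ 2 +
        8 * Real.pi ^ 2 * (s : ℝ) ^ 2 * (L : ℝ) ^ 2 * pairNormConst g ^ 2 := by
  have hP : (star (pairBoost L ((s : ℤ) : ZMod L) *ᵥ ψ) ⬝ᵥ
        (((pairField g L)ᴴ * pairField g L) *ᵥ (pairBoost L ((s : ℤ) : ZMod L) *ᵥ ψ))).re =
      ‖(WithLp.toLp 2 (((pairBoost L ((s : ℤ) : ZMod L))ᴴ * pairField g L *
          pairBoost L ((s : ℤ) : ZMod L)) *ᵥ ψ) :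
              EuclideanSpace ℂ (Finset (Orb (FermionTorus 2 L))))‖ ^ 2 := by
    rw [← Literature.MathematicalPhysics.QuantumLattice.star_mulVec_dotProduct_mulVec,
      norm_toLp_sq_eq_re]
    exact congrArg Complex.re (star_conj_phaseGauge_mulVec_dotProduct _ _ _).symm
  rw [hP]
  have hψ : ‖(WithLp.toLp 2 ψ :
      EuclideanSpace ℂ (Finset (Orb (FermionTorus 2 L))))‖ = 1 :=
    norm_toLp_eq_one_of_star_dotProduct h1
  have hdev := norm_toLp_pairBoost_conj_pairField_sub_pairFieldAt_mulVec_le g s ψ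
  rw [hψ, mul_one] at hdev
  have heq : (WithLp.toLp 2 (((pairBoost L ((s : ℤ) : ZMod L))ᴴ * pairField g L *
          pairBoost L ((s : ℤ) : ZMod L)) *ᵥ ψ) :
              EuclideanSpace ℂ (Finset (Orb (FermionTorus 2 L)))) =
      WithLp.toLp 2 (pairFieldAt g L (pairBoostLabel L ((s : ℤ) : ZMod L)) *ᵥ ψ) +
        WithLp.toLp 2 ((((pairBoost L ((s : ℤ) : ZMod L))ᴴ * pairField g L *
            pairBoost L ((s : ℤ) : ZMod L)) -
          pairFieldAt g L (pairBoostLabel L ((s : ℤ) : ZMod L))) *ᵥ ψ) := by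
    rw [Matrix.sub_mulVec, WithLp.toLp_sub, add_sub_cancel]
  have hle : ‖(WithLp.toLp 2 (((pairBoost L ((s : ℤ) : ZMod L))ᴴ * pairField g L *
          pairBoost L ((s : ℤ) : ZMod L)) *ᵥ ψ) :
              EuclideanSpace ℂ (Finset (Orb (FermionTorus 2 L))))‖ ≤
      ‖(WithLp.toLp 2 (pairFieldAt g L (pairBoostLabel L ((s : ℤ) : ZMod L)) *ᵥ ψ) :
          EuclideanSpace ℂ (Finset (Orb (FermionTorus 2 L))))‖ +
        2 * Real.pi * |(s : ℝ)| * L * pairNormConst g := by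
    rw [heq]
    exact norm_add_le_of_le le_rfl hdev
  have hsq : ‖(WithLp.toLp 2 (((pairBoost L ((s : ℤ) : ZMod L))ᴴ * pairField g L *
          pairBoost L ((s : ℤ) : ZMod L)) *ᵥ ψ) :
              EuclideanSpace ℂ (Finset (Orb (FermionTorus 2 L))))‖ ^ 2 ≤
      (‖(WithLp.toLp 2 (pairFieldAt g L (pairBoostLabel L ((s : ℤ) : ZMod L)) *ᵥ ψ) :
          EuclideanSpace ℂ (Finset (Orb (FermionTorus 2 L))))‖ +
        2 * Real.pi * |(s : ℝ)| * L * pairNormConst g) ^ 2 :=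
    pow_le_pow_left₀ (norm_nonneg _) hle 2
  have key : ∀ x z : ℝ, (x + z) ^ 2 ≤ 2 * x ^ 2 + 2 * z ^ 2 := fun x z => by
    nlinarith [sq_nonneg (x - z)]
  have hs2 : |(s : ℝ)| ^ 2 = (s : ℝ) ^ 2 := sq_abs _
  have hz : (2 * Real.pi * |(s : ℝ)| * L * pairNormConst g) ^ 2 =
      4 * Real.pi ^ 2 * (s : ℝ) ^ 2 * (L : ℝ) ^ 2 * pairNormConst g ^ 2 := by
    rw [← hs2]; ring
  calc _ ≤ _ := hsq
    _ ≤ _ := key _ _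
    _ = _ := by rw [hz]; ring

/-- **Parseval over the boost window** (`4M < L`, `⟨ψ,ψ⟩ = 1`): the labels `m_{±j}`,
`1 ≤ j ≤ M`, are pairwise distinct, so
`Σ_{j=1}^{M} (‖Δ_g(m_j)ψ‖² + ‖Δ_g(m_{-j})ψ‖²) ≤ Σ_m ‖Δ_g(m)ψ‖² = L² Σ_x ‖P_x ψ‖² ≤ C_g² L⁴`. -/
theorem sum_Icc_normSq_pairFieldAt_pairBoostLabel_le (g : Site 2 → ℝ) {M : ℕ} (hML : 4 * M < L)
    {ψ : Fock (Orb (FermionTorus 2 L))} (h1 : star ψ ⬝ᵥ ψ = 1) :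
    ∑ j ∈ Finset.Icc (1 : ℤ) M,
        (‖(WithLp.toLp 2 (pairFieldAt g L (pairBoostLabel L ((j : ℤ) : ZMod L)) *ᵥ ψ) :
            EuclideanSpace ℂ (Finset (Orb (FermionTorus 2 L))))‖ ^ 2 +
          ‖(WithLp.toLp 2 (pairFieldAt g L (pairBoostLabel L ((-j : ℤ) : ZMod L)) *ᵥ ψ) :
            EuclideanSpace ℂ (Finset (Orb (FermionTorus 2 L))))‖ ^ 2) ≤
      (L : ℝ) ^ 4 * pairNormConst g ^ 2 := by
  classical
  set a : TorusSite 2 L → ℝ :=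
    fun m => ‖(WithLp.toLp 2 (pairFieldAt g L m *ᵥ ψ) :
        EuclideanSpace ℂ (Finset (Orb (FermionTorus 2 L))))‖ ^ 2 with ha
  set lab : ℤ → TorusSite 2 L := fun s => pairBoostLabel L ((s : ℤ) : ZMod L) with hlab
  set S : Finset ℤ := Finset.Icc (1 : ℤ) M with hS
  show ∑ j ∈ S, (a (lab j) + a (lab (-j))) ≤ _
  have hψ : ‖(WithLp.toLp 2 ψ :
      EuclideanSpace ℂ (Finset (Orb (FermionTorus 2 L))))‖ = 1 :=
    norm_toLp_eq_one_of_star_dotProduct h1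
  have hmemS : ∀ x ∈ S, 1 ≤ x ∧ x ≤ M := fun x hx => Finset.mem_Icc.1 hx
  have hmemT : ∀ x ∈ S.image Neg.neg, -(M : ℤ) ≤ x ∧ x ≤ -1 := fun x hx => by
    obtain ⟨y, hy, rfl⟩ := Finset.mem_image.1 hx
    have := hmemS y hy
    omega
  have hdisj : Disjoint S (S.image Neg.neg) := Finset.disjoint_left.2 fun x hx hxT => by
    have := hmemS x hx; have := hmemT x hxT; omega
  have habs : ∀ x ∈ S ∪ S.image Neg.neg, |x| ≤ M := fun x hx => by
    rw [abs_le]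
    rcases Finset.mem_union.1 hx with h | h
    · have := hmemS x h; omega
    · have := hmemT x h; omega
  have hinj : Set.InjOn lab ↑(S ∪ S.image Neg.neg) := fun x hx y hy hxy =>
    pairBoostLabel_intCast_inj hML (habs x hx) (habs y hy) hxy
  have hcard : (Fintype.card (TorusSite 2 L) : ℝ) = (L : ℝ) ^ 2 := by
    rw [Fintype.card_fun, ZMod.card, Fintype.card_fin]; push_cast; ring
  have hloc : ∀ x : TorusSite 2 L,
      ‖(WithLp.toLp 2 (localPair g L x *ᵥ ψ) :
          EuclideanSpace ℂ (Finset (Orb (FermionTorus 2 L))))‖ ^ 2 ≤ pairNormConst g ^ 2 :=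
      fun x => by
    have h := norm_toLp_localPair_mulVec_le g L x ψ
    rw [hψ, mul_one] at h
    exact pow_le_pow_left₀ (norm_nonneg _) h 2
  have hpars : ∑ m, a m = (L : ℝ) ^ 2 *
      ∑ x : TorusSite 2 L, ‖(WithLp.toLp 2 (localPair g L x *ᵥ ψ) :
          EuclideanSpace ℂ (Finset (Orb (FermionTorus 2 L))))‖ ^ 2 := by
    simp only [ha, norm_toLp_sq_eq_re]
    rw [← Complex.re_sum, sum_star_pairFieldAt_mulVec_dotProduct, ← Complex.re_sum,
      show ((L : ℂ)) ^ 2 = (((L : ℝ) ^ 2 : ℝ) : ℂ) by push_cast; ring, Complex.re_ofReal_mul]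
  calc ∑ j ∈ S, (a (lab j) + a (lab (-j)))
      = ∑ j ∈ S, a (lab j) + ∑ j ∈ S.image Neg.neg, a (lab j) := by
        rw [Finset.sum_add_distrib, Finset.sum_image fun x _ y _ h => neg_injective h]
    _ = ∑ j ∈ S ∪ S.image Neg.neg, a (lab j) := (Finset.sum_union hdisj).symm
    _ = ∑ m ∈ (S ∪ S.image Neg.neg).image lab, a m := (Finset.sum_image hinj).symm
    _ ≤ ∑ m, a m := Finset.sum_le_univ_sum_of_nonneg fun m => by positivity
    _ ≤ (L : ℝ) ^ 2 * ∑ x : TorusSite 2 L, pairNormConst g ^ 2 := by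
        rw [hpars]
        exact mul_le_mul_of_nonneg_left (Finset.sum_le_sum fun x _ => hloc x) (by positivity)
    _ = (L : ℝ) ^ 4 * pairNormConst g ^ 2 := by
        rw [Finset.sum_const, Finset.card_univ, nsmul_eq_mul, hcard]; ring

/-- **Theorem (★) of paper §12 — the boost ceiling, averaging form.** `L ≥ 3`, any `U`, any form
factor `g`, any `τ ≥ 0`, any normalised `ψ`, and `1 ≤ M`, `4M < L`: some boost `W_s ψ` with
`1 ≤ |s| ≤ M` has
`⟨W_sψ, Δ_g†Δ_g W_sψ⟩ + τ(⟨W_sψ, H W_sψ⟩ - ⟨ψ, Hψ⟩) ≤ C_g²L⁴/M + 8π²(C_g²L² + τ)M²`. -/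
theorem exists_pairBoost_pair_add_energy_le (hL : 3 ≤ L) (g : Site 2 → ℝ) (U τ : ℝ) (hτ : 0 ≤ τ)
    {ψ : Fock (Orb (FermionTorus 2 L))} (h1 : star ψ ⬝ᵥ ψ = 1) {M : ℕ} (hM : 1 ≤ M)
    (hML : 4 * M < L) :
    ∃ s : ℤ, 1 ≤ |s| ∧ |s| ≤ M ∧
      (star (pairBoost L ((s : ℤ) : ZMod L) *ᵥ ψ) ⬝ᵥ
            (((pairField g L)ᴴ * pairField g L) *ᵥ (pairBoost L ((s : ℤ) : ZMod L) *ᵥ ψ))).re +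
          τ * ((star (pairBoost L ((s : ℤ) : ZMod L) *ᵥ ψ) ⬝ᵥ
              (hubbardTorus 2 L 1 U *ᵥ (pairBoost L ((s : ℤ) : ZMod L) *ᵥ ψ))).re -
            (star ψ ⬝ᵥ (hubbardTorus 2 L 1 U *ᵥ ψ)).re) ≤
        pairNormConst g ^ 2 * (L : ℝ) ^ 4 / M +
          8 * Real.pi ^ 2 * (pairNormConst g ^ 2 * (L : ℝ) ^ 2 + τ) * (M : ℝ) ^ 2 := by
  classical
  set C := pairNormConst g with hC
  set B : ℝ := C ^ 2 * (L : ℝ) ^ 4 / M + 8 * Real.pi ^ 2 * (C ^ 2 * (L : ℝ) ^ 2 + τ) * (M : ℝ) ^ 2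
    with hB
  set E0 : ℝ := (star ψ ⬝ᵥ (hubbardTorus 2 L 1 U *ᵥ ψ)).re with hE0
  set a : TorusSite 2 L → ℝ :=
    fun m => ‖(WithLp.toLp 2 (pairFieldAt g L m *ᵥ ψ) :
        EuclideanSpace ℂ (Finset (Orb (FermionTorus 2 L))))‖ ^ 2 with ha
  set lab : ℤ → TorusSite 2 L := fun s => pairBoostLabel L ((s : ℤ) : ZMod L) with hlab
  set P : ℤ → ℝ := fun s => (star (pairBoost L ((s : ℤ) : ZMod L) *ᵥ ψ) ⬝ᵥ
    (((pairField g L)ᴴ * pairField g L) *ᵥ (pairBoost L ((s : ℤ) : ZMod L) *ᵥ ψ))).re with hP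
  set E : ℤ → ℝ := fun s => (star (pairBoost L ((s : ℤ) : ZMod L) *ᵥ ψ) ⬝ᵥ
    (hubbardTorus 2 L 1 U *ᵥ (pairBoost L ((s : ℤ) : ZMod L) *ᵥ ψ))).re with hE
  set F : ℤ → ℝ := fun s => P s + τ * (E s - E0) with hF
  show ∃ s : ℤ, 1 ≤ |s| ∧ |s| ≤ M ∧ F s ≤ B
  have hPle : ∀ s : ℤ, P s ≤ 2 * a (lab s) + 8 * Real.pi ^ 2 * (s : ℝ) ^ 2 * (L : ℝ) ^ 2 * C ^ 2 :=
    fun s => re_pair_pairBoost_le g s h1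
  have hEle : ∀ j : ℤ, E j + E (-j) ≤ 2 * E0 + 16 * Real.pi ^ 2 * (j : ℝ) ^ 2 :=
    fun j => re_energy_pairBoost_add_neg_le hL U j h1
  have hG : ∀ j : ℤ, F j + F (-j) ≤
      2 * (a (lab j) + a (lab (-j))) +
        16 * Real.pi ^ 2 * ((L : ℝ) ^ 2 * C ^ 2 + τ) * (j : ℝ) ^ 2 := by
    intro j
    have hPj := hPle j
    have hPj' := hPle (-j)
    have hEj := mul_le_mul_of_nonneg_left (hEle j) hτ
    have hneg : ((-j : ℤ) : ℝ) ^ 2 = ((j : ℤ) : ℝ) ^ 2 := by push_cast; ring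
    rw [hneg] at hPj'
    simp only [hF]
    linarith [hPj, hPj', hEj]
  have hpars : ∑ j ∈ Finset.Icc (1 : ℤ) M, (a (lab j) + a (lab (-j))) ≤ (L : ℝ) ^ 4 * C ^ 2 :=
    sum_Icc_normSq_pairFieldAt_pairBoostLabel_le g hML h1
  have hsq : ∑ j ∈ Finset.Icc (1 : ℤ) M, ((j : ℤ) : ℝ) ^ 2 ≤ (M : ℝ) * (M : ℝ) ^ 2 := by
    have h := Finset.sum_le_card_nsmul (Finset.Icc (1 : ℤ) M) (fun j : ℤ => ((j : ℤ) : ℝ) ^ 2)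
      ((M : ℝ) ^ 2) fun j hj => by
        have hj' := Finset.mem_Icc.1 hj
        have h0 : (0 : ℝ) ≤ j := by exact_mod_cast (by omega : (0 : ℤ) ≤ j)
        have hjM : (j : ℝ) ≤ M := by exact_mod_cast hj'.2
        exact pow_le_pow_left₀ h0 hjM 2
    have hcard : (Finset.Icc (1 : ℤ) M).card = M := by simp [Int.card_Icc]
    rw [hcard, nsmul_eq_mul] at h
    exact h
  have hM0 : (M : ℝ) ≠ 0 := Nat.cast_ne_zero.2 (by omega)
  have hsum : ∑ j ∈ Finset.Icc (1 : ℤ) M, (F j + F (-j)) ≤ ∑ _j ∈ Finset.Icc (1 : ℤ) M, 2 * B := by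
    have hcard : (Finset.Icc (1 : ℤ) M).card = M := by simp [Int.card_Icc]
    calc ∑ j ∈ Finset.Icc (1 : ℤ) M, (F j + F (-j))
        ≤ ∑ j ∈ Finset.Icc (1 : ℤ) M, (2 * (a (lab j) + a (lab (-j))) +
            16 * Real.pi ^ 2 * ((L : ℝ) ^ 2 * C ^ 2 + τ) * (j : ℝ) ^ 2) :=
          Finset.sum_le_sum fun j _ => hG j
      _ = 2 * ∑ j ∈ Finset.Icc (1 : ℤ) M, (a (lab j) + a (lab (-j))) +
            16 * Real.pi ^ 2 * ((L : ℝ) ^ 2 * C ^ 2 + τ) *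
              ∑ j ∈ Finset.Icc (1 : ℤ) M, ((j : ℤ) : ℝ) ^ 2 := by
          rw [Finset.sum_add_distrib, ← Finset.mul_sum, ← Finset.mul_sum]
      _ ≤ 2 * ((L : ℝ) ^ 4 * C ^ 2) +
            16 * Real.pi ^ 2 * ((L : ℝ) ^ 2 * C ^ 2 + τ) * ((M : ℝ) * (M : ℝ) ^ 2) :=
          add_le_add (mul_le_mul_of_nonneg_left hpars two_pos.le)
            (mul_le_mul_of_nonneg_left hsq (by positivity))
      _ = ∑ _j ∈ Finset.Icc (1 : ℤ) M, 2 * B := by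
          rw [Finset.sum_const, hcard, nsmul_eq_mul, hB]
          field_simp
          ring
  obtain ⟨j, hj, hjB⟩ := Finset.exists_le_of_sum_le
    (Finset.nonempty_Icc.2 (by exact_mod_cast hM)) hsum
  have hj' := Finset.mem_Icc.1 hj
  by_cases hc : F j ≤ B
  · refine ⟨j, ?_, ?_, hc⟩
    · rw [abs_of_pos (by omega)]; exact hj'.1
    · rw [abs_of_pos (by omega)]; exact hj'.2
  · refine ⟨-j, ?_, ?_, by linarith⟩
    · rw [abs_neg, abs_of_pos (by omega)]; exact hj'.1
    · rw [abs_neg, abs_of_pos (by omega)]; exact hj'.2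

/-- **Corollary (sector ground states): low-energy states with small uniform pair field.**
`L ≥ 3`, any `U`, any joint sector `(N, S^z)`, any normalised sector ground state `ψ` of
`H = hubbardTorus 2 L 1 U`, any `τ ≥ 0`, `1 ≤ M`, `4M < L`: there is a normalised `φ` IN THE SAME
SECTOR with `‖Δ_g φ‖² ≤ B` and `τ(⟨φ, Hφ⟩ - E₀(N,S^z)) ≤ B`, `B = C_g²L⁴/M + 8π²(C_g²L² + τ)M²`
— both the uniform pair amplitude and the (penalised) excitation energy of `φ` are small, whatever
the pair correlations of `ψ` itself. This is the boost ceiling (★) of paper §12: the lowest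
eigenvalue of `Δ_g†Δ_g + τ(H - E₀)` on every sector is `≤ B`, so symmetric pair-coupling
variational principles cannot separate ordered from disordered ground states. -/
theorem exists_small_pairField_low_energy_of_isGroundStateInSector (hL : 3 ≤ L) (g : Site 2 → ℝ)
    {U : ℝ} (τ : ℝ) (hτ : 0 ≤ τ) {N : ℕ} {Sz : ℝ} {ψ : Fock (Orb (FermionTorus 2 L))}
    (hgs : IsGroundStateInSector (hubbardTorus 2 L 1 U) N Sz ψ) (h1 : star ψ ⬝ᵥ ψ = 1) {M : ℕ}
    (hM : 1 ≤ M) (hML : 4 * M < L) :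
    ∃ φ ∈ szSector N Sz, star φ ⬝ᵥ φ = 1 ∧
      ‖(WithLp.toLp 2 (pairField g L *ᵥ φ) :
          EuclideanSpace ℂ (Finset (Orb (FermionTorus 2 L))))‖ ^ 2 ≤
          pairNormConst g ^ 2 * (L : ℝ) ^ 4 / M +
            8 * Real.pi ^ 2 * (pairNormConst g ^ 2 * (L : ℝ) ^ 2 + τ) * (M : ℝ) ^ 2 ∧
        τ * ((star φ ⬝ᵥ (hubbardTorus 2 L 1 U *ᵥ φ)).re -
            (hubbardTorus 2 L 1 U).minEnergyOn (szSector N Sz)) ≤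
          pairNormConst g ^ 2 * (L : ℝ) ^ 4 / M +
            8 * Real.pi ^ 2 * (pairNormConst g ^ 2 * (L : ℝ) ^ 2 + τ) * (M : ℝ) ^ 2 := by
  obtain ⟨s, -, -, hs⟩ := exists_pairBoost_pair_add_energy_le hL g U τ hτ h1 hM hML
  set φ := pairBoost L ((s : ℤ) : ZMod L) *ᵥ ψ with hφ
  have hφmem : φ ∈ szSector N Sz := pairBoost_mulVec_mem_szSector _ hgs.1
  have hφ1 : star φ ⬝ᵥ φ = 1 := by rw [hφ]; exact (star_phaseGauge_mulVec_dotProduct _ ψ).trans h1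
  have hH : (hubbardTorus 2 L 1 U).IsHermitian := LiebThm1.hamiltonian_isHermitian _ 1 U
  have hE0 : (star ψ ⬝ᵥ (hubbardTorus 2 L 1 U *ᵥ ψ)).re =
      (hubbardTorus 2 L 1 U).minEnergyOn (szSector N Sz) := by
    rw [hgs.2.2, dotProduct_smul, h1, smul_eq_mul, mul_one, Complex.ofReal_re]
  rw [hE0] at hs
  have hpair : (star φ ⬝ᵥ (((pairField g L)ᴴ * pairField g L) *ᵥ φ)).re =
      ‖(WithLp.toLp 2 (pairField g L *ᵥ φ) :
          EuclideanSpace ℂ (Finset (Orb (FermionTorus 2 L))))‖ ^ 2 := by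
    rw [← Literature.MathematicalPhysics.QuantumLattice.star_mulVec_dotProduct_mulVec,
      norm_toLp_sq_eq_re]
  have hpair0 : 0 ≤ (star φ ⬝ᵥ (((pairField g L)ᴴ * pairField g L) *ᵥ φ)).re := by
    rw [hpair]; positivity
  have hexc : 0 ≤ τ * ((star φ ⬝ᵥ (hubbardTorus 2 L 1 U *ᵥ φ)).re -
      (hubbardTorus 2 L 1 U).minEnergyOn (szSector N Sz)) :=
    mul_nonneg hτ (sub_nonneg.2 (minEnergyOn_le_rayleigh_of_mem hH _ hφmem hφ1))
  exact ⟨φ, hφmem, hφ1, by rw [← hpair]; linarith, by linarith⟩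

end Summit.HubbardSuperconductivity.HubbardSuperconductivity.Theorems
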